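import Summits.BirchSwinnertonDyer.Rank1Residual.X12.CMRamifiedAdditive
import Literature.NumberTheory.EllipticCurves.BurungaleCastellaSkinnerTian2022.CMPConverse
import Literature.NumberTheory.EllipticCurves.RootNumberProofs
import Literature.NumberTheory.EllipticCurves.BSDConductor
import Literature.NumberTheory.DiophantineGeometry.ConductorFactorizationProofs
import HarnessLib

/-!
# The CM rank-one `p`-converse at `p = 2` and `p = 3`: Burungale–Castella–Skinner–Tian's conductor hypothesis is AUTOMATIC off `d_K ∈ {−3, −4, −8}`

HONEST FRAMING (cell `b2b-bsdres`, run/shared/lean/b2b/bsd-rank1-residual/, verbatim in every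
file): the goal of the cell is to DELETE the COMBINATION-SHAPED residual classes of the
Birch–Swinnerton-Dyer formula for ALL analytic-rank `≤ 1` elliptic curves over `ℚ` — "full BSD
formula for every rank `≤ 1` curve in class `C`" assembled STRICTLY from published theorems — so
that the rank-`≤ 1` remainder becomes exactly the CONSTRUCTION-SHAPED classes, which are TYPED
(missing-input `Prop`s), NOT attempted. This is not "finishing BSD". Literature typer seat
`b2b-bsdres-lit-bst` (source: Burungale–Skinner–Tian / Burungale–Castella–Skinner–Tian). Theorems
only (no definition, no named fact, no axiom); RANK-PART statements only (a `p`-CONVERSE, not a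
`p`-part of the BSD formula): class X12 REMAINS CONSTRUCTION-SHAPED; nothing is booked; no label
and no census number moves.

## What is proved (compositions of tree theorems BY NAME)

The Literature fact `BurungaleCastellaSkinnerTian2022.thmA_analyticRank_eq_one_of_selmerCorank_eq_one`
(Ann. Math. Québec 46 (2022), Thm. A, p. 326: CM by an order of `K`, `𝔡_K ∥ 𝔣_λ`, `p` ANY good
ordinary prime ⟹ (`corank_{ℤ_p} Sel_{p^∞}(E/ℚ) = 1 ⟹ ord_{s=1} L(E, s) = 1`)) carries the
printed conductor hypothesis "the Hecke character associated to `E` has conductor exactly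
divisible by `𝔡_K`", transcribed on `N_E` as
`DifferentExactlyDividesHeckeConductor W := ∀ ℓ prime, ℓ ∣ d_K → v_ℓ(N_E) = 2 · v_ℓ(|d_K|)`.

* `differentExactlyDividesHeckeConductor_of_hasCM_of_ne` — **the hypothesis holds for EVERY CM
  curve over `ℚ` whose CM field is not `ℚ(√−3)`, `ℚ(i)`, `ℚ(√−2)`** (`d_K ∉ {−3, −4, −8}`, i.e.
  `d_K ∈ {−7, −11, −19, −43, −67, −163}`): then the only prime `ℓ ∣ d_K` is `ℓ = −d_K ≥ 7`, a CM
  curve is ADDITIVE at an odd ramified prime (harvest-1's `X12.addv_of_hasCM_of_cmRamified`: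
  Silverman *AT* II Ex. 2.12(b), II.6.4, IV.9.4; Burungale–Flach's twist isogeny), additive at
  `ℓ ≥ 5` means `f_ℓ = 2` (Silverman *AT* IV.10.2(b): tree theorem
  `conductorExponent_eq_two_of_five_le_of_isElliptic`), and `v_ℓ(N_E) = f_ℓ` (*AEC* C.16,
  `factorization_conductorNorm_holds`); the prime-indexed and place-indexed reduction predicates
  agree (`hasGoodReductionAtPrime_iff_hasGoodReductionAt_holds`,
  `hasMultiplicativeReductionAtPrime_iff_hasMultiplicativeReductionAt_holds`, *AEC* VII.5.1).
* `analyticRank_eq_one_of_goodOrd_two` — **Theorem A at `p = 2` with NO conductor hypothesis**: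
  a CM curve `E/ℚ` with GOOD ORDINARY reduction at `2` and `corank_{ℤ_2} Sel_{2^∞}(E/ℚ) = 1` has
  `ord_{s=1} L(E, s) = 1` — because good ordinary at `2` forces `K = ℚ(√−7)` (the Literature
  corner theorem `cmFieldDiscrOfJ_eq_of_goodOrd_two`, from Deuring's criterion), where the
  hypothesis is automatic. Binders: the BCST fact `hA` and the Deuring fact `hDeu`
  (`deuring_not_hasUnitRootAt_of_hasCM_of_not_cmSplit`). With Gross–Zagier–Kolyvagin (`hGZK`) also
  `rank E(ℚ) = 1 ∧ #Ш(E/ℚ) < ∞` (`rank_eq_one_and_finite_sha_of_goodOrd_two`).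
* `analyticRank_eq_one_of_goodOrd_three_of_j_ne` — the same at `p = 3` for the `ℚ(√−11)`-curves
  (`j ≠ 8000`; for `j = 8000`, `K = ℚ(√−2)`, the hypothesis is the genuine condition `v_2(N_E) = 6`
  and stays explicit: `analyticRank_eq_one_of_goodOrd_three`).

So the tree's CM rank-one `p`-converse now reads, binder-free in the conductor: `p ≥ 5` good
ordinary — Burungale–Tian 2020 (no hypothesis); `p = 2` — this file (no hypothesis); `p = 3`,
`K = ℚ(√−11)` — this file (no hypothesis); `p = 3`, `K = ℚ(√−2)` — BCST Thm. A with `v_2(N_E) = 6`.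

References: A. Burungale, F. Castella, C. Skinner, Y. Tian, Ann. Math. Québec 46 (2022) 325–346,
Thm. A (p. 326), Rem. D (p. 327), §3.3 (p. 334), §8 (p. 342) [BurungaleCastellaSkinnerTian2022];
J. H. Silverman, *Advanced Topics* (1994) II.6.4, IV.10.2, App. A §3 [SilvermanATAEC1994];
*AEC* (2009) VII.5.1, C.16 [SilvermanAEC2009]; S. Lang, *Elliptic Functions* Ch. 13 §4 Thm. 12
[Lang1987]; H. Darmon, CBMS 101, Thm. 3.22 [Darmon2004].
-/

set_option autoImplicit false

noncomputable section

open scoped Classical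

open IsDedekindDomain IsDedekindDomain.HeightOneSpectrum NumberField Rat.HeightOneSpectrum
  WeierstrassCurve Literature.NumberTheory.EllipticCurves
  Literature.NumberTheory.EllipticCurves.Rank1Residual
  Literature.NumberTheory.EllipticCurves.BurungaleCastellaSkinnerTian2022

namespace Summit.BirchSwinnertonDyer.Rank1Residual.X12

/-! ## §1 The CM fields other than `ℚ(√−3)`, `ℚ(i)`, `ℚ(√−2)`: `d_K = −ℓ` with `ℓ ≥ 7` prime -/

/-- For a CM curve with `d_K ∉ {−3, −4, −8}`: `d_K ∈ {−7, −11, −19, −43, −67, −163}` (the table of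
the thirteen CM `j`-invariants). [cite: SilvermanATAEC1994, App. A §3 (table of CM j-invariants)] -/
theorem cmFieldDiscrOfJ_mem_of_ne (W : WeierstrassCurve ℚ) [W.IsElliptic] (hCM : W.HasCM)
    (h3 : cmFieldDiscrOfJ W.j ≠ -3) (h4 : cmFieldDiscrOfJ W.j ≠ -4) (h8 : cmFieldDiscrOfJ W.j ≠ -8) :
    cmFieldDiscrOfJ W.j = -7 ∨ cmFieldDiscrOfJ W.j = -11 ∨ cmFieldDiscrOfJ W.j = -19 ∨
      cmFieldDiscrOfJ W.j = -43 ∨ cmFieldDiscrOfJ W.j = -67 ∨ cmFieldDiscrOfJ W.j = -163 := by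
  have h0 : cmFieldDiscrOfJ W.j ≠ 0 := cmFieldDiscrOfJ_ne_zero_of_hasCM W hCM
  rcases cmFieldDiscrOfJ_cases W.j with hd | hd | hd | hd | hd | hd | hd | hd | hd | hd <;>
    simp_all

/-- For a CM curve with `d_K ∉ {−3, −4, −8}` and a prime `ℓ ∣ d_K`: `ℓ = |d_K|`, `ℓ ≥ 7`, and
`v_ℓ(|d_K|) = 1`. [cite: SilvermanATAEC1994, App. A §3 (table of CM j-invariants)] -/
theorem eq_natAbs_of_dvd_cmFieldDiscrOfJ_of_ne (W : WeierstrassCurve ℚ) [W.IsElliptic]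
    (hCM : W.HasCM) (h3 : cmFieldDiscrOfJ W.j ≠ -3) (h4 : cmFieldDiscrOfJ W.j ≠ -4)
    (h8 : cmFieldDiscrOfJ W.j ≠ -8) {ℓ : ℕ} (hℓ : ℓ.Prime) (hdvd : (ℓ : ℤ) ∣ cmFieldDiscrOfJ W.j) :
    ℓ = (cmFieldDiscrOfJ W.j).natAbs ∧ 7 ≤ ℓ ∧ (cmFieldDiscrOfJ W.j).natAbs.factorization ℓ = 1 := by
  have hdn : ℓ ∣ (cmFieldDiscrOfJ W.j).natAbs := Int.natCast_dvd.mp hdvd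
  -- `|d_K|` is a prime `≥ 7`
  have hq : ((cmFieldDiscrOfJ W.j).natAbs).Prime ∧ 7 ≤ (cmFieldDiscrOfJ W.j).natAbs := by
    rcases cmFieldDiscrOfJ_mem_of_ne W hCM h3 h4 h8 with hd | hd | hd | hd | hd | hd <;>
      rw [hd] <;> norm_num
  obtain ⟨hqprime, hq7⟩ := hq
  have hℓq : ℓ = (cmFieldDiscrOfJ W.j).natAbs := (Nat.prime_dvd_prime_iff_eq hℓ hqprime).mp hdn
  refine ⟨hℓq, hℓq ▸ hq7, ?_⟩
  rw [hℓq]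
  exact hqprime.factorization_self

/-- `d_K = −8` only for `j = 8000` (the table). [cite: SilvermanATAEC1994, App. A §3 (table of CM j-invariants)] -/
theorem cmFieldDiscrOfJ_ne_neg_eight_of_j_ne (W : WeierstrassCurve ℚ) [W.IsElliptic]
    (hj : W.j ≠ 8000) :
    cmFieldDiscrOfJ W.j ≠ -8 := by
  unfold cmFieldDiscrOfJ
  split_ifs <;> simp_all

/-! ## §2 Additive reduction at `ℓ ≥ 5` gives `v_ℓ(N_E) = 2` (prime-indexed form) -/

/-- **`add(ℓ)` at a prime `ℓ ≥ 5` gives `v_ℓ(N_E) = 2`** — Silverman *AT* IV.10.2(b) (`f_ℓ = 2`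
for additive reduction in residue characteristic `≥ 5`, tree theorem
`conductorExponent_eq_two_of_five_le_of_isElliptic`) read on `N_E = ∏ ℓ^{f_ℓ}` (*AEC* C.16,
`factorization_conductorNorm_holds`), the cell predicate `Addv W ℓ` (neither good nor
multiplicative at `ℓ`, `ℤ_ℓ`-minimal model) being additive reduction at the place of `ℤ` over `ℓ`
by the local trichotomy (*AEC* VII.5.1) and the prime/place bridges
`hasGoodReductionAtPrime_iff_hasGoodReductionAt_holds`,
`hasMultiplicativeReductionAtPrime_iff_hasMultiplicativeReductionAt_holds`.
[cite: SilvermanATAEC1994, Thm. IV.10.2] [cite: SilvermanAEC2009, VII.5 Prop. 5.1 and C.16] -/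
theorem factorization_conductorNorm_eq_two_of_addv (W : WeierstrassCurve ℚ) [W.IsElliptic]
    (ℓ : ℕ) [hℓ : Fact ℓ.Prime] (h5 : 5 ≤ ℓ) (hadd : Addv W ℓ) :
    (W.conductorNorm ℤ).factorization ℓ = 2 := by
  set vZ : HeightOneSpectrum ℤ := (primesEquiv (R := ℤ)).symm ⟨ℓ, hℓ.out⟩ with hvZ
  have hgen : natGenerator vZ = ℓ := by
    change ((primesEquiv vZ : Nat.Primes) : ℕ) = ℓ
    rw [hvZ, Equiv.apply_symm_apply]
  -- additive reduction at the place `vZ`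
  have hng : ¬ W.HasGoodReductionAt vZ := fun h ↦
    hadd.1 ((W.hasGoodReductionAtPrime_iff_hasGoodReductionAt_holds ⟨ℓ, hℓ.out⟩).mpr h)
  have hnm : ¬ W.HasMultiplicativeReductionAt vZ := fun h ↦
    hadd.2 ((hasMultiplicativeReductionAtPrime_iff_hasMultiplicativeReductionAt_holds W
      ⟨ℓ, hℓ.out⟩).mpr h)
  have haddZ : W.HasAdditiveReductionAt vZ := by
    rcases W.hasGoodReductionAt_or_hasMultiplicativeReductionAt_or_hasAdditiveReductionAt vZ with
      h | h | h
    · exact absurd h hng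
    · exact absurd h hnm
    · exact h
  have hf2 : W.conductorExponent vZ = 2 :=
    conductorExponent_eq_two_of_five_le_of_isElliptic W vZ (by rw [hgen]; exact h5) haddZ
  have hfac := factorization_conductorNorm_holds W vZ
  rw [hgen] at hfac
  rw [hfac, hf2]

/-! ## §3 The conductor hypothesis of Theorem A is automatic off `d_K ∈ {−3, −4, −8}` -/

/-- **Burungale–Castella–Skinner–Tian's hypothesis "`𝔡_K ∥ 𝔣_λ`" (transcribed:
`DifferentExactlyDividesHeckeConductor W`) holds for EVERY CM elliptic curve over `ℚ` whose CM
field is not `ℚ(√−3)`, `ℚ(i)` or `ℚ(√−2)`.** For such a curve the only prime `ℓ ∣ d_K` is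
`ℓ = −d_K ∈ {7, 11, 19, 43, 67, 163}`; a CM curve is additive at an odd ramified prime
(`X12.addv_of_hasCM_of_cmRamified`) and `f_ℓ = 2` at an additive `ℓ ≥ 5`
(`factorization_conductorNorm_eq_two_of_addv`), while `v_ℓ(|d_K|) = 1`; so
`v_ℓ(N_E) = 2 = 2 · v_ℓ(|d_K|)`. (For `d_K ∈ {−3, −4, −8}` the hypothesis is a genuine condition:
`v_3(N_E) = 2`, `v_2(N_E) = 4`, `v_2(N_E) = 6` respectively — module docstring of the Literature
file.) [cite: BurungaleCastellaSkinnerTian2022, Thm. A (p. 326) and §8 (c) (p. 342)]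
[cite: SilvermanATAEC1994, Thm. IV.10.2 and App. A §3] -/
theorem differentExactlyDividesHeckeConductor_of_hasCM_of_ne (W : WeierstrassCurve ℚ)
    [W.IsElliptic] (hCM : W.HasCM) (h3 : cmFieldDiscrOfJ W.j ≠ -3)
    (h4 : cmFieldDiscrOfJ W.j ≠ -4) (h8 : cmFieldDiscrOfJ W.j ≠ -8) :
    DifferentExactlyDividesHeckeConductor W := by
  intro ℓ hℓ hdvd
  obtain ⟨-, h7, hfac1⟩ := eq_natAbs_of_dvd_cmFieldDiscrOfJ_of_ne W hCM h3 h4 h8 hℓ hdvd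
  haveI : Fact ℓ.Prime := ⟨hℓ⟩
  have hadd : Addv W ℓ := addv_of_hasCM_of_cmRamified W ℓ hCM (by omega) hdvd
  rw [hfac1, factorization_conductorNorm_eq_two_of_addv W ℓ (by omega) hadd]

/-- The `ℚ(√−7)` case: `d_K = −7` gives the hypothesis. [cite: BurungaleCastellaSkinnerTian2022, Thm. A (p. 326), Rem. D (p. 327)] -/
theorem differentExactlyDividesHeckeConductor_of_cmFieldDiscrOfJ_eq_neg_seven
    (W : WeierstrassCurve ℚ) [W.IsElliptic] (hCM : W.HasCM) (hd : cmFieldDiscrOfJ W.j = -7) :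
    DifferentExactlyDividesHeckeConductor W :=
  differentExactlyDividesHeckeConductor_of_hasCM_of_ne W hCM (by rw [hd]; decide)
    (by rw [hd]; decide) (by rw [hd]; decide)

/-- The `ℚ(√−11)` case: `d_K = −11` gives the hypothesis. [cite: BurungaleCastellaSkinnerTian2022, Thm. A (p. 326)] -/
theorem differentExactlyDividesHeckeConductor_of_cmFieldDiscrOfJ_eq_neg_eleven
    (W : WeierstrassCurve ℚ) [W.IsElliptic] (hCM : W.HasCM) (hd : cmFieldDiscrOfJ W.j = -11) :
    DifferentExactlyDividesHeckeConductor W :=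
  differentExactlyDividesHeckeConductor_of_hasCM_of_ne W hCM (by rw [hd]; decide)
    (by rw [hd]; decide) (by rw [hd]; decide)

/-! ## §4 Theorem A at `p = 2` and at `p = 3` with the conductor hypothesis discharged -/

/-- **The CM rank-one `2`-converse, hypothesis-free in the conductor.** For a CM elliptic curve
`E/ℚ` (globally minimal model `W`, to read `a_2`) with GOOD ORDINARY reduction at `2`
(`2 ∤ N_E`, `a_2` odd): `corank_{ℤ_2} Sel_{2^∞}(E/ℚ) = 1 ⟹ ord_{s=1} L(E, s) = 1`. Proof: good
ordinary at `2` forces `K = ℚ(√−7)` (Deuring, `cmFieldDiscrOfJ_eq_of_goodOrd_two`, binder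
`hDeu`), where BCST's conductor hypothesis is automatic (§3), so Theorem A (binder `hA`) applies.
RANK-PART only; not a `2`-part-of-BSD statement (X12 ∧ `p = 2` untouched).
[cite: BurungaleCastellaSkinnerTian2022, Thm. A (p. 326) and Rem. D (p. 327)]
[cite: Lang1987, Ch. 13 §4 Thm. 12] -/
theorem analyticRank_eq_one_of_goodOrd_two
    (hA : thmA_analyticRank_eq_one_of_selmerCorank_eq_one)
    (hDeu : deuring_not_hasUnitRootAt_of_hasCM_of_not_cmSplit)
    (W : WeierstrassCurve ℚ) [W.IsElliptic] [W.IsGloballyMinimal] (hCM : W.HasCM)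
    [Fact (2 : ℕ).Prime] (hgood : W.HasGoodReductionAtPrime 2)
    (hord : ¬ ((2 : ℕ) : ℤ) ∣ W.frobeniusTrace 2) (hcorank : W.selmerCorank 2 = 1) :
    W.analyticRank = 1 :=
  hA W hCM (differentExactlyDividesHeckeConductor_of_cmFieldDiscrOfJ_eq_neg_seven W hCM
    (cmFieldDiscrOfJ_eq_of_goodOrd_two hDeu W hCM hgood hord)) 2 hgood hord hcorank

/-- **… and then `rank E(ℚ) = 1` and `#Ш(E/ℚ) < ∞`** (Theorem A's "In particular" at `p = 2`, via
Gross–Zagier–Kolyvagin–Rubin `hGZK`). [cite: BurungaleCastellaSkinnerTian2022, Thm. A (p. 326)]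
[cite: Darmon2004, Thm. 3.22] -/
theorem rank_eq_one_and_finite_sha_of_goodOrd_two
    (hA : thmA_analyticRank_eq_one_of_selmerCorank_eq_one)
    (hDeu : deuring_not_hasUnitRootAt_of_hasCM_of_not_cmSplit)
    (hGZK : rank_eq_analyticRank_of_analyticRank_le_one)
    (W : WeierstrassCurve ℚ) [W.IsElliptic] [W.IsGloballyMinimal] (hCM : W.HasCM)
    [Fact (2 : ℕ).Prime] (hgood : W.HasGoodReductionAtPrime 2)
    (hord : ¬ ((2 : ℕ) : ℤ) ∣ W.frobeniusTrace 2) (hcorank : W.selmerCorank 2 = 1) :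
    W.analyticRank = 1 ∧ W.mordellWeilRank = 1 ∧ Finite W.sha :=
  thmA_inParticular hA hGZK W hCM
    (differentExactlyDividesHeckeConductor_of_cmFieldDiscrOfJ_eq_neg_seven W hCM
      (cmFieldDiscrOfJ_eq_of_goodOrd_two hDeu W hCM hgood hord)) 2 hgood hord hcorank

/-- **The CM rank-one `3`-converse for the `ℚ(√−11)`-curves, hypothesis-free in the conductor.**
For a CM curve with good ordinary reduction at `3` and `j ≠ 8000` (so `K = ℚ(√−11)`, `j = −32768`,
by `cmFieldDiscrOfJ_eq_of_goodOrd_three`): `corank_{ℤ_3} Sel_{3^∞}(E/ℚ) = 1 ⟹ ord_{s=1} L(E, s) = 1`.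
[cite: BurungaleCastellaSkinnerTian2022, Thm. A (p. 326)] [cite: Lang1987, Ch. 13 §4 Thm. 12]
[cite: SilvermanATAEC1994, App. A §3 (table of CM j-invariants)] -/
theorem analyticRank_eq_one_of_goodOrd_three_of_j_ne
    (hA : thmA_analyticRank_eq_one_of_selmerCorank_eq_one)
    (hDeu : deuring_not_hasUnitRootAt_of_hasCM_of_not_cmSplit)
    (W : WeierstrassCurve ℚ) [W.IsElliptic] [W.IsGloballyMinimal] (hCM : W.HasCM)
    (hj : W.j ≠ 8000) [Fact (3 : ℕ).Prime] (hgood : W.HasGoodReductionAtPrime 3)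
    (hord : ¬ ((3 : ℕ) : ℤ) ∣ W.frobeniusTrace 3) (hcorank : W.selmerCorank 3 = 1) :
    W.analyticRank = 1 := by
  have h11 : cmFieldDiscrOfJ W.j = -11 := by
    rcases cmFieldDiscrOfJ_eq_of_goodOrd_three hDeu W hCM hgood hord with h | h
    · exact absurd h (cmFieldDiscrOfJ_ne_neg_eight_of_j_ne W hj)
    · exact h
  exact hA W hCM (differentExactlyDividesHeckeConductor_of_cmFieldDiscrOfJ_eq_neg_eleven W hCM h11)
    3 hgood hord hcorank

/-- **The CM rank-one `3`-converse at every good ordinary `3`, with the conductor hypothesis kept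
only where it is a condition** (`K = ℚ(√−2)`, `j = 8000`: `v_2(N_E) = 6`; for `K = ℚ(√−11)` it is
discharged by §3). [cite: BurungaleCastellaSkinnerTian2022, Thm. A (p. 326)]
[cite: Lang1987, Ch. 13 §4 Thm. 12] -/
theorem analyticRank_eq_one_of_goodOrd_three
    (hA : thmA_analyticRank_eq_one_of_selmerCorank_eq_one)
    (hDeu : deuring_not_hasUnitRootAt_of_hasCM_of_not_cmSplit)
    (W : WeierstrassCurve ℚ) [W.IsElliptic] [W.IsGloballyMinimal] (hCM : W.HasCM)
    (hcond8 : cmFieldDiscrOfJ W.j = -8 → DifferentExactlyDividesHeckeConductor W)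
    [Fact (3 : ℕ).Prime] (hgood : W.HasGoodReductionAtPrime 3)
    (hord : ¬ ((3 : ℕ) : ℤ) ∣ W.frobeniusTrace 3) (hcorank : W.selmerCorank 3 = 1) :
    W.analyticRank = 1 := by
  rcases cmFieldDiscrOfJ_eq_of_goodOrd_three hDeu W hCM hgood hord with h | h
  · exact hA W hCM (hcond8 h) 3 hgood hord hcorank
  · exact hA W hCM (differentExactlyDividesHeckeConductor_of_cmFieldDiscrOfJ_eq_neg_eleven W hCM h)
      3 hgood hord hcorank

end Summit.BirchSwinnertonDyer.Rank1Residual.X12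

end
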